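import Mathlib
import HarnessLib
import Literature.Analysis.FluidPDE.VorticityCalculus
import Literature.Analysis.FluidPDE.BiotSavartHolder
import Literature.Analysis.FluidPDE.BiotSavartHolderCurl
import Literature.Analysis.FluidPDE.BiotSavartBounds
import Literature.Analysis.FluidPDE.BiotSavartCurlPair
import Literature.Analysis.FluidPDE.HarmonicBallMeanValue
import Literature.Analysis.FluidPDE.SingularKernelGradient
import Literature.Analysis.FluidPDE.PoincareHomotopyOperatorL2

/-!
# Crux `IsobarTomography.BlobRiccatiClosure` (stmt-NavierStokesRegularity-11740), line
# `type-i-apex-liouville` — tools for the div–curl tomography of the velocity gradient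

Helper file (theorems only) `--supports` the item (registered stub `stub_divCurlHarmonicBound`,
the last theorem). Ingredients of the local div–curl estimate
`‖∇W(x)‖ ≤ c₀ (B + A/R + √(R B B₁) + √(A A₁/R))` (next file, `stub_divCurlGradientBound`):

* the localised vorticity `f = curl (χ_R W)`: it vanishes with its support outside `B̄(x, 2R)`
  (`divCurl_curl_localise_eq_zero_of_far`, `divCurl_tsupport_curl_localise_subset`), agrees with
  `curl W` on `B(x, R)` (`divCurl_curl_localise_eq_of_mem_ball`) and equals `χ ω + ∇χ × W`
  (`divCurl_curl_localise_eq`, the Leibniz rule `curl_smul` — cf. the landed `stub_curlSmul`);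
* square-root bookkeeping (`divCurl_sqrt_algebra`: the four Hölder-½ terms against `√(2R)` in
  scale-homogeneous form) and the bookkeeping of the universal constant (`divCurl_const_bounds`);
* the interior gradient estimate for a vector field harmonic on a ball at scale `R`,
  `‖∇h(y)‖ ≤ c₃ sup_{B̄(y,R)}|h| / R` (`stub_divCurlHarmonicBound`), from the tree's weighted
  mean-value gradient formula on balls (`abs_fderiv_apply_le_of_laplacian_eq_zero`,
  Gilbarg–Trudinger Thm 2.10) with the rescaled weight `λ^{R/4,R/2}`
  (`divCurl_norm_fderiv_newtonFarLaplacian_scale_le`) and `|B̄(y, R/2)| = (R/2)³|B₁|`.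

## References

* D. Gilbarg, N. S. Trudinger, *Elliptic PDE of Second Order* (2001), Thm 2.10. [GilbargTrudinger2001]
* A. J. Majda, A. L. Bertozzi, *Vorticity and Incompressible Flow* (CUP 2002), §1.1, §4.1.3. [MajdaBertozziCUP2002]
-/

noncomputable section

open Set Filter Topology Function MeasureTheory Metric
open scoped RealInnerProductSpace NNReal Laplacian

-- the summit and its single sub-problem share the name (CONVENTIONS §1), as in every Theorems file
set_option linter.dupNamespace false

namespace Summit.NavierStokesRegularity.NavierStokesRegularity.Theorems.BlobRiccatiClosure.TypeIApexLiouville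

open Literature.Analysis Literature.Analysis.FluidPDE

/-! ### The localised vorticity `f = curl (χ_R W)` -/

section Localise

variable {W : EuclideanSpace ℝ (Fin 3) → EuclideanSpace ℝ (Fin 3)} {x : EuclideanSpace ℝ (Fin 3)}
  {R : ℝ}

/-- The localised field `χ_R W` vanishes, together with its curl, outside `B̄(x, 2R)`:
`curl (χ_R W)(y) = 0` for `2R < ‖y − x‖`. [folklore] -/
theorem divCurl_curl_localise_eq_zero_of_far (hR : 0 < R) {y : EuclideanSpace ℝ (Fin 3)}
    (hy : 2 * R < ‖y - x‖) : curl (fun z => suppCutoff x R z • W z) y = 0 := by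
  apply curl_eq_zero_of_fderiv_eq_zero
  have hev : (fun z => suppCutoff x R z • W z) =ᶠ[𝓝 y] fun _ => (0 : EuclideanSpace ℝ (Fin 3)) := by
    have hopen : IsOpen {z : EuclideanSpace ℝ (Fin 3) | 2 * R < ‖z - x‖} :=
      isOpen_lt continuous_const (continuous_id.sub continuous_const).norm
    filter_upwards [hopen.mem_nhds hy] with z hz
    rw [suppCutoff_eq_zero hR (le_of_lt hz), zero_smul]
  rw [hev.fderiv_eq, fderiv_const_apply]

/-- Hence `tsupport (curl (χ_R W)) ⊆ B̄(x, 2R)`. [folklore] -/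
theorem divCurl_tsupport_curl_localise_subset (hR : 0 < R) :
    tsupport (curl (fun z => suppCutoff x R z • W z)) ⊆ closedBall x (2 * R) := by
  refine closure_minimal (fun y hy => ?_) isClosed_closedBall
  rw [mem_closedBall, dist_eq_norm]
  by_contra h
  exact hy (divCurl_curl_localise_eq_zero_of_far hR (not_le.1 h))

/-- Inside `B(x, R)` the localised field agrees with `W` to first order:
`curl (χ_R W)(w) = curl W(w)` for `w ∈ B(x, R)`. [folklore] -/
theorem divCurl_curl_localise_eq_of_mem_ball (hR : 0 < R) {w : EuclideanSpace ℝ (Fin 3)}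
    (hw : w ∈ ball x R) : curl (fun z => suppCutoff x R z • W z) w = curl W w := by
  have hev : (fun z => suppCutoff x R z • W z) =ᶠ[𝓝 w] W := by
    filter_upwards [isOpen_ball.mem_nhds hw] with z hz
    rw [mem_ball, dist_eq_norm] at hz
    rw [suppCutoff_eq_one hR hz.le, one_smul]
  rw [curl_eq_curlCLM, curl_eq_curlCLM, hev.fderiv_eq]

/-- The Leibniz formula for the localised vorticity: `curl (χ_R W) = χ_R curl W + ∇χ_R × W`
(for `W` differentiable). [folklore] -/
theorem divCurl_curl_localise_eq (hW : Differentiable ℝ W) :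
    curl (fun z => suppCutoff x R z • W z) =
      fun y => suppCutoff x R y • curl W y + cross (gradient (suppCutoff x R) y) (W y) := by
  funext y
  rw [curl_smul ((contDiff_suppCutoff x R (n := 1)).differentiable one_ne_zero y) (hW y),
    fderiv_eq_innerSL_gradient, curlCLM_smulRight_innerSL]

end Localise

/-! ### Square-root bookkeeping -/

/-- `√(2R) · √(2t) = 2 √(R t)` for `R, t ≥ 0`. [folklore] -/
theorem divCurl_sqrt_two_mul_mul_sqrt_two_mul {R : ℝ} (hR : 0 ≤ R) (t : ℝ) :
    Real.sqrt (2 * R) * Real.sqrt (2 * t) = 2 * Real.sqrt (R * t) := by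
  rw [← Real.sqrt_mul (by positivity : (0 : ℝ) ≤ 2 * R),
    show 2 * R * (2 * t) = 2 ^ 2 * (R * t) by ring, Real.sqrt_mul (by norm_num : (0 : ℝ) ≤ 2 ^ 2),
    Real.sqrt_sq (by norm_num : (0 : ℝ) ≤ 2)]

/-- The four Hölder terms of the localised vorticity against `√(2R)`, in scale-homogeneous form:
`√(2R)·(√(2BB₁) + B√(2c₁/R) + (c₁/R)√(2AA₁) + A√(2(c₁/R)(c₂/R²)))
 = 2√(RBB₁) + 2√c₁·B + 2c₁√(AA₁/R) + 2√(c₁c₂)·A/R`. [folklore] -/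
theorem divCurl_sqrt_algebra (A A₁ B B₁ c₁ c₂ : ℝ) {R : ℝ} (hR : 0 < R) :
    Real.sqrt (2 * R) * (Real.sqrt (2 * B * B₁) + B * Real.sqrt (2 * 1 * (c₁ / R)) +
        (c₁ / R * Real.sqrt (2 * A * A₁) + A * Real.sqrt (2 * (c₁ / R) * (c₂ / R ^ 2)))) =
      2 * Real.sqrt (R * B * B₁) + 2 * Real.sqrt c₁ * B + 2 * c₁ * Real.sqrt (A * A₁ / R) +
        2 * Real.sqrt (c₁ * c₂) * (A / R) := by
  have hR0 : 0 ≤ R := hR.le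
  have e1 : Real.sqrt (2 * R) * Real.sqrt (2 * B * B₁) = 2 * Real.sqrt (R * B * B₁) := by
    rw [show 2 * B * B₁ = 2 * (B * B₁) by ring, divCurl_sqrt_two_mul_mul_sqrt_two_mul hR0 _,
      mul_assoc]
  have e2 : Real.sqrt (2 * R) * Real.sqrt (2 * 1 * (c₁ / R)) = 2 * Real.sqrt c₁ := by
    rw [show 2 * 1 * (c₁ / R) = 2 * (c₁ / R) by ring,
      divCurl_sqrt_two_mul_mul_sqrt_two_mul hR0 _, mul_div_cancel₀ _ hR.ne']
  have e3 : Real.sqrt (2 * R) * Real.sqrt (2 * A * A₁) = 2 * (R * Real.sqrt (A * A₁ / R)) := by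
    rw [show 2 * A * A₁ = 2 * (A * A₁) by ring, divCurl_sqrt_two_mul_mul_sqrt_two_mul hR0 _]
    congr 1
    rw [show R * (A * A₁) = R ^ 2 * (A * A₁ / R) by field_simp, Real.sqrt_mul (by positivity),
      Real.sqrt_sq hR0]
  have e4 : Real.sqrt (2 * R) * Real.sqrt (2 * (c₁ / R) * (c₂ / R ^ 2)) = 2 * (Real.sqrt (c₁ * c₂) / R) := by
    rw [show 2 * (c₁ / R) * (c₂ / R ^ 2) = 2 * ((c₁ / R) * (c₂ / R ^ 2)) by ring,
      divCurl_sqrt_two_mul_mul_sqrt_two_mul hR0 _]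
    congr 1
    rw [show R * (c₁ / R * (c₂ / R ^ 2)) = (c₁ * c₂) / R ^ 2 by field_simp, Real.sqrt_div' _ (by positivity),
      Real.sqrt_sq hR0]
  have expand : Real.sqrt (2 * R) * (Real.sqrt (2 * B * B₁) + B * Real.sqrt (2 * 1 * (c₁ / R)) +
        (c₁ / R * Real.sqrt (2 * A * A₁) + A * Real.sqrt (2 * (c₁ / R) * (c₂ / R ^ 2)))) =
      Real.sqrt (2 * R) * Real.sqrt (2 * B * B₁) + B * (Real.sqrt (2 * R) * Real.sqrt (2 * 1 * (c₁ / R))) +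
        (c₁ / R * (Real.sqrt (2 * R) * Real.sqrt (2 * A * A₁)) +
          A * (Real.sqrt (2 * R) * Real.sqrt (2 * (c₁ / R) * (c₂ / R ^ 2)))) := by ring
  rw [expand, e1, e2, e3, e4]
  field_simp
  ring

/-- Bookkeeping of the universal constant: the four coefficients are dominated by
`c₀ = c(2 + 2√c₁ + 2c₁ + 2√(c₁c₂) + 1 + c₁) + c₃(11 + 10c₁) + 1`. [folklore] -/
theorem divCurl_const_bounds {cBS c₁ c₂ c₃ : ℝ} (hcBS0 : 0 ≤ cBS) (hc₁ : 0 ≤ c₁) (hc₂ : 0 ≤ c₂)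
    (hc₃ : 0 ≤ c₃) :
    cBS * (2 * Real.sqrt c₁ + 1) + 10 * c₃ ≤
        cBS * (2 + 2 * Real.sqrt c₁ + 2 * c₁ + 2 * Real.sqrt (c₁ * c₂) + 1 + c₁) +
          c₃ * (1 + 10 + 10 * c₁) + 1 ∧
      cBS * (2 * Real.sqrt (c₁ * c₂) + c₁) + c₃ * (1 + 10 * c₁) ≤
        cBS * (2 + 2 * Real.sqrt c₁ + 2 * c₁ + 2 * Real.sqrt (c₁ * c₂) + 1 + c₁) +
          c₃ * (1 + 10 + 10 * c₁) + 1 ∧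
      2 * cBS ≤
        cBS * (2 + 2 * Real.sqrt c₁ + 2 * c₁ + 2 * Real.sqrt (c₁ * c₂) + 1 + c₁) +
          c₃ * (1 + 10 + 10 * c₁) + 1 ∧
      2 * c₁ * cBS ≤
        cBS * (2 + 2 * Real.sqrt c₁ + 2 * c₁ + 2 * Real.sqrt (c₁ * c₂) + 1 + c₁) +
          c₃ * (1 + 10 + 10 * c₁) + 1 := by
  have hsc₁ : 0 ≤ Real.sqrt c₁ := Real.sqrt_nonneg _
  have hsc₁₂ : 0 ≤ Real.sqrt (c₁ * c₂) := Real.sqrt_nonneg _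
  have hp1 : 0 ≤ cBS * c₁ := mul_nonneg hcBS0 hc₁
  have hp2 : 0 ≤ cBS * Real.sqrt c₁ := mul_nonneg hcBS0 hsc₁
  have hp3 : 0 ≤ cBS * Real.sqrt (c₁ * c₂) := mul_nonneg hcBS0 hsc₁₂
  have hp4 : 0 ≤ c₃ * c₁ := mul_nonneg hc₃ hc₁
  have _hc₂ := hc₂
  refine ⟨by nlinarith, by nlinarith, by nlinarith, by nlinarith⟩

/-! ### Interior gradient bound for fields harmonic on a ball, at scale `R` -/

/-- Gradient bound for the rescaled weight `λ^{c, 2c}`: from `‖Dλ^{1,2}‖ ≤ M` one gets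
`‖Dλ^{c,2c}(z)‖ ≤ c⁻⁴ M` (`λ^{c,2c}(z) = c⁻³ λ^{1,2}(c⁻¹ z)`, chain rule). [folklore] -/
theorem divCurl_norm_fderiv_newtonFarLaplacian_scale_le {c M : ℝ} (hc : 0 < c)
    (hM : ∀ z : EuclideanSpace ℝ (Fin 3), ‖fderiv ℝ (newtonFarLaplacian 1 2) z‖ ≤ M)
    (z : EuclideanSpace ℝ (Fin 3)) :
    ‖fderiv ℝ (newtonFarLaplacian (c * 1) (c * 2)) z‖ ≤ c⁻¹ ^ 4 * M := by
  have hfun : newtonFarLaplacian (c * 1) (c * 2) =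
      fun z : EuclideanSpace ℝ (Fin 3) => c⁻¹ ^ 3 * newtonFarLaplacian 1 2 (c⁻¹ • z) :=
    funext fun z => newtonFarLaplacian_scale hc 1 2 z
  have hsm : ContDiff ℝ 1 (newtonFarLaplacian 1 2 : EuclideanSpace ℝ (Fin 3) → ℝ) :=
    contDiff_newtonFarLaplacian one_pos one_lt_two
  have hd : DifferentiableAt ℝ (newtonFarLaplacian 1 2 : EuclideanSpace ℝ (Fin 3) → ℝ) (c⁻¹ • z) :=
    (hsm.differentiable one_ne_zero) _
  have h1 : HasFDerivAt (fun z : EuclideanSpace ℝ (Fin 3) => c⁻¹ • z)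
      (c⁻¹ • ContinuousLinearMap.id ℝ (EuclideanSpace ℝ (Fin 3))) z :=
    (hasFDerivAt_id z).const_smul c⁻¹
  have h2 : HasFDerivAt (fun z : EuclideanSpace ℝ (Fin 3) => newtonFarLaplacian 1 2 (c⁻¹ • z))
      ((fderiv ℝ (newtonFarLaplacian 1 2) (c⁻¹ • z)).comp
        (c⁻¹ • ContinuousLinearMap.id ℝ (EuclideanSpace ℝ (Fin 3)))) z :=
    hd.hasFDerivAt.comp z h1
  have h3 : HasFDerivAt (newtonFarLaplacian (c * 1) (c * 2))
      ((c⁻¹ ^ 3) • ((fderiv ℝ (newtonFarLaplacian 1 2) (c⁻¹ • z)).comp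
        (c⁻¹ • ContinuousLinearMap.id ℝ (EuclideanSpace ℝ (Fin 3))))) z := by
    rw [hfun]
    exact h2.const_mul (c⁻¹ ^ 3)
  rw [h3.fderiv, norm_smul, norm_pow, norm_inv, Real.norm_eq_abs, abs_of_pos hc]
  have hc0 : 0 ≤ c⁻¹ := by positivity
  have hM0 : 0 ≤ M := (norm_nonneg _).trans (hM 0)
  have hid : ‖c⁻¹ • ContinuousLinearMap.id ℝ (EuclideanSpace ℝ (Fin 3))‖ ≤ c⁻¹ := by
    rw [norm_smul, norm_inv, Real.norm_eq_abs, abs_of_pos hc]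
    exact mul_le_of_le_one_right hc0 ContinuousLinearMap.norm_id_le
  have hcomp : ‖(fderiv ℝ (newtonFarLaplacian 1 2) (c⁻¹ • z)).comp
        (c⁻¹ • ContinuousLinearMap.id ℝ (EuclideanSpace ℝ (Fin 3)))‖ ≤ M * c⁻¹ :=
    (ContinuousLinearMap.opNorm_comp_le _ _).trans
      (mul_le_mul (hM _) hid (norm_nonneg _) hM0)
  calc c⁻¹ ^ 3 * ‖(fderiv ℝ (newtonFarLaplacian 1 2) (c⁻¹ • z)).comp
          (c⁻¹ • ContinuousLinearMap.id ℝ (EuclideanSpace ℝ (Fin 3)))‖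
      ≤ c⁻¹ ^ 3 * (M * c⁻¹) := mul_le_mul_of_nonneg_left hcomp (by positivity)
    _ = c⁻¹ ^ 4 * M := by ring

/-- **Interior gradient bound for a vector field harmonic on a ball, scale `R` (registered stub
`stub_divCurlHarmonicBound`).** There is a
universal `c₃ ≥ 0` such that: if `h : ℝ³ → ℝ³` is `C²`, (vector-)harmonic on the open ball
`B(y, R)` and bounded by `S` on the closed ball `B̄(y, R)`, then `‖Dh(y)‖ ≤ c₃ S / R`
(Gilbarg–Trudinger Thm 2.10 applied to the three coordinates through the tree's weighted-mean-value
gradient formula `abs_fderiv_apply_le_of_laplacian_eq_zero` with the weight `λ^{R/4, R/2}`,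
`‖Dλ^{R/4,R/2}‖ ≤ (4/R)⁴ M₁`, `|B̄(y, R/2)| = (R/2)³ |B₁|`). [cite: GilbargTrudinger2001, Thm 2.10] -/
theorem stub_divCurlHarmonicBound : ∃ c₃ : ℝ, 0 ≤ c₃ ∧ ∀ (h : EuclideanSpace ℝ (Fin 3) → EuclideanSpace ℝ (Fin 3)) (y : EuclideanSpace ℝ (Fin 3)) (R S : ℝ), 0 < R → ContDiff ℝ 2 h → (∀ w ∈ Metric.ball y R, (Δ h) w = 0) → (∀ w ∈ Metric.closedBall y R, ‖h w‖ ≤ S) → ‖fderiv ℝ h y‖ ≤ c₃ * S / R := by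
  obtain ⟨M₁, hM₁0, hM₁⟩ := exists_bound_fderiv_newtonFarLaplacian (r₀ := (1 : ℝ)) (r₁ := 2)
    one_pos one_lt_two
  set V₁ : ℝ := (volume : Measure (EuclideanSpace ℝ (Fin 3))).real (ball 0 1) with hV₁
  have hV₁0 : 0 ≤ V₁ := measureReal_nonneg
  refine ⟨2 * (32 * M₁ * V₁), by positivity, fun h y R S hR hh hΔ hS => ?_⟩
  have hS0 : 0 ≤ S := (norm_nonneg _).trans (hS y (mem_closedBall_self hR.le))
  -- the weight at scale `c = R/4`: `λ^{R/4, R/2}`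
  set c : ℝ := R / 4 with hc
  have hc0 : 0 < c := by positivity
  have hlam : ∀ z, ‖fderiv ℝ (newtonFarLaplacian (c * 1) (c * 2)) z‖ ≤ c⁻¹ ^ 4 * M₁ :=
    divCurl_norm_fderiv_newtonFarLaplacian_scale_le hc0 hM₁
  have h₀ : (0 : ℝ) < c * 1 := by positivity
  have h₁ : c * 1 < c * 2 := by nlinarith
  have hρ : c * 2 < R := by rw [hc]; linarith
  -- coordinates
  have hcoord : ∀ (i : Fin 3) (a : EuclideanSpace ℝ (Fin 3)),
      |fderiv ℝ h y a i| ≤ ‖a‖ * (c⁻¹ ^ 4 * M₁) * (S * ((c * 2) ^ 3 * V₁)) := by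
    intro i a
    set η : EuclideanSpace ℝ (Fin 3) → ℝ := fun z => h z i with hη
    have hηeq : η = (EuclideanSpace.proj i : EuclideanSpace ℝ (Fin 3) →L[ℝ] ℝ) ∘ h := by
      funext z; rfl
    have hη2 : ContDiff ℝ 2 η := by
      rw [hηeq]; exact (EuclideanSpace.proj i : EuclideanSpace ℝ (Fin 3) →L[ℝ] ℝ).contDiff.comp hh
    have hηΔ : ∀ w ∈ ball y R, (Δ η) w = 0 := fun w hw => by
      rw [hηeq, (hh.contDiffAt (x := w)).laplacian_CLM_comp_left, Function.comp_apply, hΔ w hw,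
        map_zero]
    have key := abs_fderiv_apply_le_of_laplacian_eq_zero h₀ h₁ hη2 hρ hηΔ hlam a
    -- the coordinate of the derivative is the derivative of the coordinate
    have hderiv : fderiv ℝ h y a i = fderiv ℝ η y a := by
      rw [hηeq, fderiv_comp y (EuclideanSpace.proj i : EuclideanSpace ℝ (Fin 3) →L[ℝ] ℝ).differentiableAt
        ((hh.differentiable (by norm_num)) y), ContinuousLinearMap.fderiv]
      rfl
    rw [hderiv]
    refine key.trans ?_
    have hint : ∫ w in closedBall y (c * 2), |η w| ≤ S * ((c * 2) ^ 3 * V₁) := by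
      have hlt : volume (closedBall y (c * 2)) < ⊤ := measure_closedBall_lt_top
      have hle : ∀ w ∈ closedBall y (c * 2), ‖|η w|‖ ≤ S := by
        intro w hw
        rw [Real.norm_eq_abs, abs_abs]
        have hw' : w ∈ closedBall y R := closedBall_subset_closedBall hρ.le hw
        exact (le_trans (by simpa [hη, Real.norm_eq_abs] using PiLp.norm_apply_le (h w) i) (hS w hw'))
      have h1 := norm_setIntegral_le_of_norm_le_const hlt hle
      rw [Real.norm_eq_abs, abs_of_nonneg (integral_nonneg fun _ => abs_nonneg _)] at h1
      refine h1.trans (le_of_eq ?_)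
      rw [Measure.addHaar_real_closedBall _ _ (by positivity : (0 : ℝ) ≤ c * 2),
        finrank_euclideanSpace_fin]
    have ha : 0 ≤ ‖a‖ * (c⁻¹ ^ 4 * M₁) := by positivity
    exact mul_le_mul_of_nonneg_left hint ha
  -- the coordinate bound in closed form: `c⁻⁴ (2c)³ = 32/R`
  have hK : ∀ (i : Fin 3) (a : EuclideanSpace ℝ (Fin 3)),
      |fderiv ℝ h y a i| ≤ (32 * M₁ * V₁) * S / R * ‖a‖ := by
    intro i a
    refine (hcoord i a).trans (le_of_eq ?_)
    rw [hc]
    field_simp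
    ring
  -- assemble the operator norm
  refine ContinuousLinearMap.opNorm_le_bound _ (by positivity) fun a => ?_
  set K : ℝ := (32 * M₁ * V₁) * S / R * ‖a‖ with hKdef
  have hK0 : 0 ≤ K := by positivity
  have hsq : ∑ i : Fin 3, ‖fderiv ℝ h y a i‖ ^ 2 ≤ 3 * K ^ 2 := by
    calc ∑ i : Fin 3, ‖fderiv ℝ h y a i‖ ^ 2 ≤ ∑ _i : Fin 3, K ^ 2 := by
          refine Finset.sum_le_sum fun i _ => ?_
          rw [Real.norm_eq_abs]
          exact pow_le_pow_left₀ (abs_nonneg _) (hK i a) 2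
      _ = 3 * K ^ 2 := by simp
  calc ‖fderiv ℝ h y a‖ = Real.sqrt (∑ i : Fin 3, ‖fderiv ℝ h y a i‖ ^ 2) := EuclideanSpace.norm_eq _
    _ ≤ Real.sqrt ((2 * K) ^ 2) := Real.sqrt_le_sqrt (by nlinarith)
    _ = 2 * K := Real.sqrt_sq (by positivity)
    _ = 2 * (32 * M₁ * V₁) * S / R * ‖a‖ := by rw [hKdef]; ring


end Summit.NavierStokesRegularity.NavierStokesRegularity.Theorems.BlobRiccatiClosure.TypeIApexLiouville

end
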